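import Mathlib
import Summits.MatrixMultiplication.MatrixMultiplication.Theses.LevelGradedCohnUmans

/-!
# `SnLevelDesigns` (stmt-MatrixMultiplication-7613), line `garnir-annihilator`:
# K3 `stub_hubPairs` — explicit hub-gadget pairs with `|X|·|Z| = C(m,k)·(m)_k` in `S_{2m+k}`

Crux `Summit.MatrixMultiplication.MatrixMultiplication.Theses.LevelGradedCohnUmans.SnLevelDesigns`;
skeleton `Cruxes/SnLevelDesigns/Lines/garnir_annihilator.lean` (registered stub K3);
this file proves the registered stub `stub_hubPairs` verbatim (name + signature, tree-only
vocabulary) and lands `--supports stmt-MatrixMultiplication-7613`.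

The construction (`n := 2m + k`). The points of `Fin n` split into three blocks of letters
(`hp_letters`): the A-letters `A a = a` (`a < m`), the B-letters `B b = m + b` (`b < m`) and the
`k` hubs `hub i = 2m + i`; the three blocks are pairwise disjoint. For an injective word
`c : Fin k → Fin n` avoiding the hubs, the hub gadget of `c` (`hp_gad_exists`) is the involution
swapping `hub i ↔ c i` for every `i` and fixing everything else (a product of `k` disjoint
transpositions, built with `Function.Involutive.toPerm`). Then
* `X` is the image of the `k`-subsets `S` of `Fin m` under `S ↦ gad (A ∘ e_S)`, where `e_S` is the
  increasing enumeration of `S` (`Finset.orderEmbOfFin`); the gadget recovers `S` as the images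
  of the hubs, so `|X| = C(m,k)` (`hp_card_ksets`);
* `Z` is the image of the injective words `b : Fin k ↪ Fin m` under `b ↦ gad (B ∘ b)`; again the
  hubs recover `b`, so `|Z| = (m)_k` (`Fintype.card_embedding_eq`).

Junta. For the target `(x₀, z₀) = (gad (A ∘ e_{S₀}), gad (B ∘ b₀))` take the frame `ι := B ∘ b₀`.
The target values are `x₀⁻¹ (z₀ (B (b₀ i))) = x₀ (hub i) = A (e_{S₀} i)`, all A-letters. For a
garbage pair `(gad (A ∘ e_S), gad (B ∘ b))` the inner gadget sends `B (b₀ i)` to `hub j` when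
`b j = b₀ i` and fixes it otherwise, and the outer gadget sends `hub j ↦ A (e_S j)` and fixes
B-letters; so agreement on `ι` forces, for every `i`, a `j` with `b j = b₀ i` and
`e_S j = e_{S₀} i`. Hence `S₀ ⊆ S`, so `S₀ = S` (equal cardinalities), then `j = i` by injectivity
of the enumeration, so `b = b₀`: the pair is the target itself.

Proof uses Mathlib only (`Function.Involutive.toPerm`, `Equiv.Perm.inv_def`,
`Finset.orderEmbOfFin`, `Finset.range_orderEmbOfFin`, `Finset.eq_of_subset_of_card_le`,
`Fintype.card_of_subtype`, `Finset.card_powersetCard`, `Fintype.card_embedding_eq`); no new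
definitions (the gadgets are packaged as existence statements and chosen with `choose`).
-/

-- the problem path repeats `MatrixMultiplication` (summit = problem), as in every file of this line
set_option linter.dupNamespace false

namespace Summit.MatrixMultiplication.MatrixMultiplication.Theorems.SnLevelDesigns

open Function

/-- The hub gadget. Given the hubs `hub : Fin k ↪ Fin n` and an injective word `c : Fin k → Fin n`
avoiding the hubs, there is a permutation `σ` of `Fin n` which is its own inverse, swaps
`hub i ↔ c i` for every `i`, and fixes every point that is neither a hub nor a letter of `c`
(the product of the `k` disjoint transpositions `(hub i, c i)`). -/
theorem hp_gad_exists {n k : ℕ} (hub : Fin k ↪ Fin n) (c : Fin k → Fin n) (hc : Injective c)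
    (hch : ∀ i j, c i ≠ hub j) :
    ∃ σ : Equiv.Perm (Fin n), σ⁻¹ = σ ∧ (∀ i, σ (hub i) = c i) ∧ (∀ i, σ (c i) = hub i) ∧
      ∀ p, (∀ i, hub i ≠ p) → (∀ i, c i ≠ p) → σ p = p := by
  classical
  obtain ⟨f, hf⟩ : ∃ f : Fin n → Fin n, ∀ p, f p =
      if h : ∃ i, hub i = p then c (Classical.choose h)
      else if h' : ∃ i, c i = p then hub (Classical.choose h') else p := ⟨_, fun _ => rfl⟩
  have hf_hub : ∀ i, f (hub i) = c i := by
    intro i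
    have h : ∃ j, hub j = hub i := ⟨i, rfl⟩
    rw [hf, dif_pos h]
    exact congrArg c (hub.injective (Classical.choose_spec h))
  have hf_val : ∀ i, f (c i) = hub i := by
    intro i
    have h : ¬ ∃ j, hub j = c i := fun ⟨j, hj⟩ => hch i j hj.symm
    have h' : ∃ j, c j = c i := ⟨i, rfl⟩
    rw [hf, dif_neg h, dif_pos h']
    congr 1
    exact hc (Classical.choose_spec h')
  have hf_fix : ∀ p, (∀ i, hub i ≠ p) → (∀ i, c i ≠ p) → f p = p := by
    intro p h1 h2
    have h : ¬ ∃ j, hub j = p := fun ⟨j, hj⟩ => h1 j hj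
    have h' : ¬ ∃ j, c j = p := fun ⟨j, hj⟩ => h2 j hj
    rw [hf, dif_neg h, dif_neg h']
  have hfi : Involutive f := by
    intro p
    by_cases h : ∃ i, hub i = p
    · obtain ⟨i, rfl⟩ := h
      rw [hf_hub, hf_val]
    · by_cases h' : ∃ i, c i = p
      · obtain ⟨i, rfl⟩ := h'
        rw [hf_val, hf_hub]
      · rw [hf_fix p (fun i hi => h ⟨i, hi⟩) (fun i hi => h' ⟨i, hi⟩),
          hf_fix p (fun i hi => h ⟨i, hi⟩) (fun i hi => h' ⟨i, hi⟩)]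
  refine ⟨Function.Involutive.toPerm f hfi, ?_, hf_hub, hf_val, hf_fix⟩
  rw [Equiv.Perm.inv_def]
  exact Function.Involutive.toPerm_symm _

/-- The three blocks of letters of `Fin (2m + k)`: the A-letters `a ↦ a`, the B-letters
`b ↦ m + b` (both indexed by `Fin m`) and the hubs `i ↦ 2m + i` (indexed by `Fin k`), three
embeddings with pairwise disjoint ranges. -/
theorem hp_letters (m k : ℕ) :
    ∃ (A B : Fin m ↪ Fin (2 * m + k)) (hub : Fin k ↪ Fin (2 * m + k)),
      (∀ a b, A a ≠ B b) ∧ (∀ a i, A a ≠ hub i) ∧ (∀ b i, B b ≠ hub i) := by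
  refine ⟨⟨fun a => ⟨(a : ℕ), by have := a.isLt; omega⟩,
      fun a a' h => Fin.ext (Fin.mk.inj h)⟩,
    ⟨fun b => ⟨m + (b : ℕ), by have := b.isLt; omega⟩,
      fun b b' h => Fin.ext (by have := Fin.mk.inj h; omega)⟩,
    ⟨fun i => ⟨2 * m + (i : ℕ), by have := i.isLt; omega⟩,
      fun i i' h => Fin.ext (by have := Fin.mk.inj h; omega)⟩, ?_, ?_, ?_⟩
  · intro a b h
    have h' := Fin.mk.inj h
    have := a.isLt
    omega
  · intro a i h
    have h' := Fin.mk.inj h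
    have := a.isLt
    omega
  · intro b i h
    have h' := Fin.mk.inj h
    have := b.isLt
    omega

/-- The number of `k`-subsets of `Fin m` is `C(m,k)`. -/
theorem hp_card_ksets (m k : ℕ) : Fintype.card {S : Finset (Fin m) // S.card = k} = m.choose k := by
  have H : ∀ S : Finset (Fin m),
      S ∈ Finset.powersetCard k (Finset.univ : Finset (Fin m)) ↔ S.card = k :=
    fun S => Finset.mem_powersetCard_univ
  rw [Fintype.card_of_subtype _ H, Finset.card_powersetCard, Finset.card_univ, Fintype.card_fin]

/-- **`stub_hubPairs`** (registered stub K3 of crux stmt-MatrixMultiplication-7613, line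
`garnir-annihilator`; explicit hub-gadget pairs). In `S_{2m+k}` there are sets `X`, `Z` of
permutations with `|X| = C(m,k)` and `|Z| = (m)_k = m (m-1) ⋯ (m-k+1)` such that every target
`x₀⁻¹ z₀` (`x₀ ∈ X`, `z₀ ∈ Z`) is told apart from every other `x⁻¹ z` (`(x, z) ≠ (x₀, z₀)`) by its
restriction to a frame `ι : Fin k → Fin (2m+k)` depending on the target (an `XZ`-junta product
family). Construction: `X` = hub gadgets of the A-letter enumerations `A ∘ e_S` of the `k`-subsets
`S` of `Fin m`, `Z` = hub gadgets of the B-letter words `B ∘ b` of the injective words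
`b : Fin k ↪ Fin m`, frame of the target `(x₀, z₀)` = the B-letters `B ∘ b₀` of `z₀`; see the
module docstring for the junta argument. -/
theorem stub_hubPairs :
    ∀ (m k : ℕ), ∃ X Z : Finset (Equiv.Perm (Fin (2 * m + k))),
      X.card = m.choose k ∧ Z.card = m.descFactorial k ∧
        ∀ x₀ ∈ X, ∀ z₀ ∈ Z, ∃ ι : Fin k → Fin (2 * m + k), ∀ x ∈ X, ∀ z ∈ Z,
          ¬ (x = x₀ ∧ z = z₀) → (⇑(x⁻¹ * z)) ∘ ι ≠ (⇑(x₀⁻¹ * z₀)) ∘ ι := by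
  intro m k
  obtain ⟨A, B, hub, hAB, hAhub, hBhub⟩ := hp_letters m k
  choose gad hinv hhub hval hfix using hp_gad_exists hub
  -- side conditions of the two gadget families: `A ∘ e_S` and `B ∘ b` are injective hub-free words
  have hcA : ∀ (S : Finset (Fin m)) (hS : S.card = k), Injective (⇑A ∘ ⇑(S.orderEmbOfFin hS)) :=
    fun S hS => A.injective.comp (S.orderEmbOfFin hS).injective
  have hchA : ∀ (S : Finset (Fin m)) (hS : S.card = k) (i j : Fin k),
      (⇑A ∘ ⇑(S.orderEmbOfFin hS)) i ≠ hub j := fun S hS i j => hAhub _ _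
  have hcB : ∀ b : Fin k ↪ Fin m, Injective (⇑B ∘ ⇑b) := fun b => B.injective.comp b.injective
  have hchB : ∀ (b : Fin k ↪ Fin m) (i j : Fin k), (⇑B ∘ ⇑b) i ≠ hub j := fun b i j => hBhub _ _
  -- evaluation rules of the two gadget families
  have hhubA : ∀ (S : Finset (Fin m)) (hS : S.card = k) (i : Fin k),
      gad _ (hcA S hS) (hchA S hS) (hub i) = A (S.orderEmbOfFin hS i) :=
    fun S hS i => hhub _ _ _ i
  have hfixA : ∀ (S : Finset (Fin m)) (hS : S.card = k) (p : Fin (2 * m + k)),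
      (∀ i, hub i ≠ p) → (∀ i, A (S.orderEmbOfFin hS i) ≠ p) →
        gad _ (hcA S hS) (hchA S hS) p = p :=
    fun S hS p h1 h2 => hfix _ _ _ p h1 h2
  have hhubB : ∀ (b : Fin k ↪ Fin m) (i : Fin k), gad _ (hcB b) (hchB b) (hub i) = B (b i) :=
    fun b i => hhub _ _ _ i
  have hvalB : ∀ (b : Fin k ↪ Fin m) (i : Fin k), gad _ (hcB b) (hchB b) (B (b i)) = hub i :=
    fun b i => hval _ _ _ i
  have hfixB : ∀ (b : Fin k ↪ Fin m) (p : Fin (2 * m + k)),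
      (∀ i, hub i ≠ p) → (∀ i, B (b i) ≠ p) → gad _ (hcB b) (hchB b) p = p :=
    fun b p h1 h2 => hfix _ _ _ p h1 h2
  -- the two families, as functions of the index data
  obtain ⟨xP, hxP⟩ : ∃ xP : {S : Finset (Fin m) // S.card = k} → Equiv.Perm (Fin (2 * m + k)),
      ∀ (S : Finset (Fin m)) (hS : S.card = k), xP ⟨S, hS⟩ = gad _ (hcA S hS) (hchA S hS) :=
    ⟨fun S => gad _ (hcA S.1 S.2) (hchA S.1 S.2), fun _ _ => rfl⟩
  obtain ⟨zP, hzP⟩ : ∃ zP : (Fin k ↪ Fin m) → Equiv.Perm (Fin (2 * m + k)),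
      ∀ b, zP b = gad _ (hcB b) (hchB b) := ⟨_, fun _ => rfl⟩
  refine ⟨Finset.univ.image xP, Finset.univ.image zP, ?_, ?_, ?_⟩
  · -- `|X| = C(m,k)`: the gadget of `S` recovers `S` as the images of the hubs
    have hinj : Injective xP := by
      rintro ⟨S, hS⟩ ⟨T, hT⟩ h
      rw [hxP S hS, hxP T hT] at h
      have hST : ∀ i, S.orderEmbOfFin hS i = T.orderEmbOfFin hT i := by
        intro i
        have hi := Equiv.congr_fun h (hub i)
        rw [hhubA, hhubA] at hi
        exact A.injective hi
      have hST' : S = T := by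
        rw [← Finset.coe_inj, ← Finset.range_orderEmbOfFin S hS,
          ← Finset.range_orderEmbOfFin T hT]
        exact congrArg Set.range (funext hST)
      exact Subtype.ext hST'
    rw [Finset.card_image_of_injective _ hinj, Finset.card_univ, hp_card_ksets]
  · -- `|Z| = (m)_k`: the gadget of `b` recovers `b` as the images of the hubs
    have hinj : Injective zP := by
      intro b b' h
      rw [hzP b, hzP b'] at h
      refine DFunLike.ext _ _ (fun i => B.injective ?_)
      have hi := Equiv.congr_fun h (hub i)
      rwa [hhubB, hhubB] at hi
    rw [Finset.card_image_of_injective _ hinj, Finset.card_univ, Fintype.card_embedding_eq]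
    simp only [Fintype.card_fin]
  · -- the junta: the frame of the target `(gad (A ∘ e_{S₀}), gad (B ∘ b₀))` is `B ∘ b₀`
    intro x₀ hx₀ z₀ hz₀
    obtain ⟨⟨S₀, hS₀⟩, -, rfl⟩ := Finset.mem_image.1 hx₀
    obtain ⟨b₀, -, rfl⟩ := Finset.mem_image.1 hz₀
    refine ⟨⇑B ∘ ⇑b₀, ?_⟩
    intro x hx z hz hne H
    obtain ⟨⟨S, hS⟩, -, rfl⟩ := Finset.mem_image.1 hx
    obtain ⟨b, -, rfl⟩ := Finset.mem_image.1 hz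
    apply hne
    rw [hxP S hS, hxP S₀ hS₀, hzP b, hzP b₀] at H
    -- Step 1: every frame value of the target forces `b j = b₀ i` with matching A-letters.
    have key : ∀ i, ∃ j, b j = b₀ i ∧ S.orderEmbOfFin hS j = S₀.orderEmbOfFin hS₀ i := by
      intro i
      have Hi := congrFun H i
      simp only [Function.comp_apply, Equiv.Perm.mul_apply, hinv] at Hi
      rw [hvalB b₀ i, hhubA S₀ hS₀ i] at Hi
      by_cases hj : ∃ j, b j = b₀ i
      · obtain ⟨j, hj⟩ := hj
        rw [← hj, hvalB b j, hhubA S hS j] at Hi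
        exact ⟨j, hj, A.injective Hi⟩
      · exfalso
        rw [hfixB b (B (b₀ i)) (fun j => (hBhub _ _).symm) (fun j h => hj ⟨j, B.injective h⟩),
          hfixA S hS (B (b₀ i)) (fun j => (hBhub _ _).symm) (fun j => hAB _ _)] at Hi
        exact hAB _ _ Hi.symm
    -- Step 2: hence `S₀ ⊆ S`, so `S₀ = S` by cardinality.
    have hsub : S₀ ⊆ S := by
      intro a ha
      have ha' : a ∈ Set.range (S₀.orderEmbOfFin hS₀) := by
        rw [Finset.range_orderEmbOfFin]
        exact ha
      obtain ⟨i, rfl⟩ := ha'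
      obtain ⟨j, -, hj⟩ := key i
      rw [← hj]
      exact Finset.orderEmbOfFin_mem S hS j
    have hSS : S₀ = S := Finset.eq_of_subset_of_card_le hsub (by rw [hS, hS₀])
    subst hSS
    -- Step 3: the matching A-letters now force `j = i`, so `b = b₀`.
    have hb : b = b₀ := by
      refine DFunLike.ext _ _ (fun i => ?_)
      obtain ⟨j, hj1, hj2⟩ := key i
      have hji : j = i := (Finset.orderEmbOfFin _ _).injective hj2
      rw [← hj1, hji]
    subst hb
    exact ⟨rfl, rfl⟩

end Summit.MatrixMultiplication.MatrixMultiplication.Theorems.SnLevelDesigns
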